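import Summits.ResolutionOfSingularities.ResolutionOfSingularities.Theorems.EquisingularLiftEquisingularLiftNatEmbeddedLiftFactDefs
import Summits.ResolutionOfSingularities.ResolutionOfSingularities.Theorems.EquisingularLiftEquisingularLiftNatCentreTwoFrame
import Summits.ResolutionOfSingularities.ResolutionOfSingularities.Theorems.EquisingularLiftEquisingularLiftNatEmbeddedLiftNose
import Literature.AlgebraicGeometry.Resolution.KollarBoundaryCentreFunctorial
import Summits.ResolutionOfSingularities.ResolutionOfSingularities.Theorems.EquisingularLiftEquisingularLiftNatDirectionLiftGlue
import Literature.AlgebraicGeometry.Resolution.SmoothOfRegularPerfectField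
import Mathlib.RingTheory.Regular.RegularSequence
import HarnessLib

/-!
# [OURS · L1 W4.5(b) · EL♮(3) · (T-k)] P0: `EmbeddedLiftFact → EmbeddedCurveLiftFact` — the tower's hypothesis-residue (T-k) REDUCED, by plumbing,
# to the general embedded-lifting statement (F) and the local-complete-intersection brick P2

Crux chain w45b (cell `res-hironaka`, slot W4.5(b)), working crux **EL♮** = stmt-ResolutionOfSingularities-20038, child **EL♮(3)** =
stmt-ResolutionOfSingularities-20148, route EquisingularLift, line `sections`; NINETEENTH/TWENTIETH registrations (res-L1-w45b-lead-2 g4): the NEED-FACT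
stub `stub_elnat_embeddedCurveLiftFact : EmbeddedCurveLiftFact` (…NatTowerRoundFourDefs, p594791). Written by res-type-027 g16 on res-L1-w45b-plan-1's
deals 2026-08-28T01:43:51Z / 01:57:35Z; (T-k) census `Cruxes/EquisingularLiftNatThree/Lines/TK-CENSUS-res-type-027.md` (bricks P0–P5).
HONEST FRAMING: OURS; NOT a statement of H. Hironaka's 2017 manuscript; AI-written, gate-checked, weaker than expert review. No `sorry`; standard axioms;
DEF-FREE. `--supports stmt-ResolutionOfSingularities-20148 --as helper`.

WHAT. `embeddedCurveLiftFact_of_embeddedLiftFact_of_lci`: the registered hypothesis-residue (T-k) `EmbeddedCurveLiftFact` (tower currency: stage `σ : X ⟶ P`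
over `q`, model square, exceptional surface `V(𝓔)` regular `O`-flat proper with reduced trace, `Z̃ ⊆ Ẽ` regular-in-regular with `DirStepUnobs` ⊢ a regular
`O`-flat centre `C ≥ 𝓔` with `C·𝒪_G = 𝓘⟨Z⟩` and 2-frames in codimension 2) FOLLOWS from
* (F) `EmbeddedLiftFact` (…NatEmbeddedLiftFactDefs, p595850: Hartshorne 2010 Thm. 22.3 with a general proper flat ambient; OURS hypothesis), and
* (P2) «regular-in-regular is a local complete intersection»: a closed immersion `i : Y₀ ⟶ W₀` (`W₀` locally Noetherian) with `Y₀` regular and `W₀`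
  regular along `Y₀` is cut out, on an affine open neighbourhood of each point, by a weakly regular sequence — taken here as an explicit ∀-closed
  HYPOTHESIS `hP2` (its ring core `exists_away_isWeaklyRegular_of_isRsopPart` is res-D-pv-035's …NatRegularSequenceAway; the assembly is desk object O1;
  when it lands, `embeddedCurveLiftFact_of_embeddedLiftFact hF := …_of_lci hF locallyRegularSequence_of_isRegular` closes P0 outright).
So the registered stub is «(F) + (P2) ⊢ (T-k)», with (F) one infinitesimal NEED-FACT deep (census joints J1/J2 = F-88/J3).

PROOF (plumbing only). (P1) The reduced exceptional surface `Ẽ = V(𝓘⟨E⟩) ≅ V(𝓔.comap j)` (the reduced-trace clause `𝓔·𝒪_G = 𝓘⟨E⟩`, Mathlib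
`IdealSheafData.inclusion` both ways) is the special fibre of `V(𝓔) → Spec O`: the cartesian square `V(𝓔.comap j) → V(𝓔)` over `j : G → X` (tree
`Resolution.isPullback_subschemeComapHom`) pasted with the stage's model square. (P2) gives (F)'s lci clause for the inclusion `ι : Z̃ ⟶ Ẽ` (`Z ⊆ E`,
`IdealSheafData.vanishingIdeal_antimono`); `DirStepUnobs G E hE Z hZ` applied to `ι` IS (F)'s Čech clause. (F) returns `C₀` on `V(𝓔)`, `O`-flat, with
`C₀·𝒪_{Ẽ} = 𝓘_{Z̃}`. (P3) `C := C₀.map (V(𝓔) ↪ X)` (Mathlib `IdealSheafData.map` = kernel of `V(C₀) ↪ V(𝓔) ↪ X`): `𝓔 ≤ C` (`map_mono`), `V(C) ≅ V(C₀)`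
(`Hom.toImage` of a closed immersion is an isomorphism) so flatness transfers (`MorphismProperty.cancel_left_of_respectsIso`), and `C·𝒪_G = 𝓘⟨Z⟩` because
`Z̃ = V(C₀) ×_X G` (Mathlib `isPullback_of_isClosedImmersion` from `C₀.comap jW = ι.ker`, pasted; `ker_fst_of_isClosedImmersion`). (P4)
`isRegular_of_flat_proper_of_isRegular_specialFibre`: `V(C₀) → Spec O` is flat, proper, with special fibre the regular `Z̃` over `k = k̄`, hence SMOOTH
(tree `Resolution.smooth_of_isRegular_of_perfectField` + Mathlib `isPullback_fiberToSpecResidueField_of_isPullback` + res-type-027 g13's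
`EmbeddedLift.smooth_of_smooth_fiber_closedPoint`), hence regular (tree `isRegularLocalRing_stalk_of_smooth`). (P5) the 2-frames under the codimension-2
clause are `exists_twoFrame_of_codim_two` (…NatCentreTwoFrame).

References (method / index only): R. Hartshorne, *Deformation Theory* (2010), Thm. 22.3; EGA IV 17.5.8 (smooth over regular is regular).
-/

set_option linter.dupNamespace false

noncomputable section

open CategoryTheory CategoryTheory.Limits AlgebraicGeometry TopologicalSpace
open Literature.AlgebraicGeometry.Resolution
open Literature.AlgebraicGeometry.Morphisms (CechMH1)
open Literature.AlgebraicGeometry.HodgeTheory (normalSheaf)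
open AlgebraicGeometry.Scheme.IdealSheafData

namespace Summit.ResolutionOfSingularities.ResolutionOfSingularities.Cruxes.EquisingularLiftNat.Sections

/-- Over a locally Noetherian base, locally of finite type ⇒ locally of finite presentation (copy of the private helper of
…NatEmbeddedLiftNose). [folklore] -/
private theorem locallyOfFinitePresentation_of_isLocallyNoetherian'' {X Y : Scheme.{0}} (g : X ⟶ Y)
    [IsLocallyNoetherian Y] [LocallyOfFiniteType g] : LocallyOfFinitePresentation g := by
  rw [HasRingHomProperty.iff_appLE (P := @LocallyOfFinitePresentation)]
  intro U V e
  haveI := IsLocallyNoetherian.component_noetherian (X := Y) U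
  exact RingHom.FinitePresentation.of_finiteType.mp
    (HasRingHomProperty.appLE @LocallyOfFiniteType g inferInstance U V e)

/-! ## P4 — regularity of an `O`-flat proper scheme with regular special fibre (`k` algebraically closed) -/

/-- **P4.** `O` a DVR with a surjection `θ : O → k` onto an algebraically closed field, `g : Y → Spec O` PROPER and FLAT with a model square
`(jY, tY)` over `θ` whose special fibre `Y₀` is REGULAR: then `Y` is a regular scheme. Route: `Y₀ → Spec k` is smooth (regular, locally of finite
type over a perfect field: tree `smooth_of_isRegular_of_perfectField`); the fibre of `g` over the closed point is that morphism up to the isomorphism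
`Spec κ(s₀) ≅ Spec k` (Mathlib `isPullback_fiberToSpecResidueField_of_isPullback`), so `g` is smooth (tree `smooth_of_smooth_fiber_closedPoint`), hence `Y`
is regular over the regular `Spec O` (tree `isRegularLocalRing_stalk_of_smooth`). [OURS · plumbing · folklore, EGA IV 17.5.8] -/
theorem isRegular_of_flat_proper_of_isRegular_specialFibre {O k : Type} [CommRing O] [IsDomain O] [IsDiscreteValuationRing O]
    [Field k] [IsAlgClosed k] (θ : O →+* k) (hθ : Function.Surjective θ)
    {Y Y₀ : Scheme.{0}} (g : Y ⟶ Spec (.of O)) [IsProper g] [Flat g] (jY : Y₀ ⟶ Y) (tY : Y₀ ⟶ Spec (.of k))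
    (hsq : IsPullback jY tY g (Spec.map (CommRingCat.ofHom θ))) (hY₀ : Scheme.IsRegular Y₀) :
    Scheme.IsRegular Y := by
  haveI : LocallyOfFiniteType tY := MorphismProperty.of_isPullback hsq inferInstance
  have hS : Smooth tY := smooth_of_isRegular_of_perfectField tY hY₀
  haveI : LocallyOfFinitePresentation g := locallyOfFinitePresentation_of_isLocallyNoetherian'' g
  -- the fibre of `g` over the point `y` of `Spec k`
  let y : ↥(Spec (CommRingCat.of k)) := default
  have hy : Spec.map (CommRingCat.ofHom θ) y = IsLocalRing.closedPoint O :=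
    LinearCentre.specMap_apply_eq_closedPoint θ hθ y
  have hfsq := isPullback_fiberToSpecResidueField_of_isPullback hsq y
  haveI : IsClosedImmersion (Spec.map (CommRingCat.ofHom θ)) := IsClosedImmersion.spec_of_surjective _ hθ
  have hbij : Function.Bijective ((Spec.map (CommRingCat.ofHom θ)).residueFieldMap y).hom :=
    ⟨((Spec.map (CommRingCat.ofHom θ)).residueFieldMap y).hom.injective,
      Literature.AlgebraicGeometry.FundamentalGroup.residueFieldMap_surjective_of_surjectiveOnStalks _ y⟩
  haveI : IsIso ((Spec.map (CommRingCat.ofHom θ)).residueFieldMap y) :=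
    (ConcreteCategory.isIso_iff_bijective _).mpr hbij
  haveI hM := hfsq.isIso_fst_of_isIso
  have hV₁ : Smooth (tY.fiberToSpecResidueField y) :=
    MorphismProperty.pullback_snd (P := @Smooth) _ _ hS
  have hV₂ : Smooth (g.fiberToSpecResidueField (Spec.map (CommRingCat.ofHom θ) y)) := by
    have hw := hfsq.w
    rw [← IsIso.eq_inv_comp] at hw
    rw [hw]
    exact MorphismProperty.comp_mem _ _ _ inferInstance (MorphismProperty.comp_mem _ _ _ hV₁ inferInstance)
  rw [hy] at hV₂
  haveI := EmbeddedLift.smooth_of_smooth_fiber_closedPoint g hV₂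
  exact fun x => isRegularLocalRing_stalk_of_smooth g x (Scheme.isRegular_Spec (.of O) _)

/-! ## P0 — the reduction -/

/-- **P0: `EmbeddedLiftFact → EmbeddedCurveLiftFact`.** The tower's hypothesis-residue (T-k) (`EmbeddedCurveLiftAt`, p594791, text verbatim) follows
from the general embedded-lifting statement (F) by plumbing: (P1) the reduced exceptional surface `Ẽ = V(𝓘⟨E⟩)` is the special fibre of
`V(𝓔) → Spec O` (`IdealSheafData.comap` is the scheme-theoretic pullback; the reduced-trace clause `𝓔·𝒪_G = 𝓘⟨E⟩`); (P2) `Z̃ ⊆ Ẽ`, regular in regular, is a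
local complete intersection; the `DirStepUnobs` datum is (F)'s Čech hypothesis verbatim; (P3) the lift `C₀` on `V(𝓔)` is pushed to the stage as
`C := C₀.map (V(𝓔) ↪ X)` (`𝓔 ≤ C`, `V(C) ≅ V(C₀)`, flatness transported, `C·𝒪_G = 𝓘⟨Z⟩` by pasting cartesian squares); (P4) `V(C)` is regular
(`isRegular_of_flat_proper_of_isRegular_specialFibre`); (P5) the 2-frames under the codimension-2 clause are `exists_twoFrame_of_codim_two`
(…NatCentreTwoFrame). [OURS · L1 W4.5b · (T-k) plumbing] toward `stub_elnat_embeddedCurveLiftFact` / `stub_elnat_defTowerPointResolution`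
(stmt-ResolutionOfSingularities-20148); NOT a statement of the manuscript. -/
theorem embeddedCurveLiftFact_of_embeddedLiftFact_of_lci (hF : EmbeddedLiftFact)
    (hP2 : ∀ ⦃Y₀ W₀ : Scheme.{0}⦄ [IsLocallyNoetherian W₀] (i : Y₀ ⟶ W₀) [IsClosedImmersion i],
      (∀ x : Y₀, IsRegularLocalRing (Y₀.presheaf.stalk x)) → (∀ x : Y₀, IsRegularLocalRing (W₀.presheaf.stalk (i x))) →
      ∀ z : Y₀, ∃ U : W₀.affineOpens, i.base z ∈ (U : W₀.Opens) ∧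
        ∃ rs : List Γ(W₀, U), RingTheory.Sequence.IsWeaklyRegular Γ(W₀, U) rs ∧ Ideal.ofList rs = i.ker.ideal U) :
    EmbeddedCurveLiftFact := by
  intro k _ _ O _ _ _ _ θ hθ P q X σ 𝓔 hXint hXnoeth hXreg h𝓔reg h𝓔flat h𝓔prop G j t hsq E hE h𝓔E Z hZ hZE hZreg
    hEreg hunobs
  haveI := hXnoeth
  haveI : IsLocallyNoetherian G := P1VB.isLocallyNoetherian_of_modelSquare θ hθ (σ ≫ q) j t hsq
  -- the ambient of (F): `W = V(𝓔)` over `Spec O`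
  set w : 𝓔.subscheme ⟶ Spec (.of O) := 𝓔.subschemeι ≫ σ ≫ q with hw
  haveI : IsProper w := h𝓔prop
  haveI : Flat w := h𝓔flat
  -- the local complete intersection downstairs: `ι : Z̃ ⟶ Ẽ`
  have hle : vanishingIdeal (⟨E, hE⟩ : Closeds G) ≤ vanishingIdeal (⟨Z, hZ⟩ : Closeds G) :=
    vanishingIdeal_antimono (show (⟨Z, hZ⟩ : Closeds G) ≤ ⟨E, hE⟩ from hZE)
  let ι : redSub G Z hZ ⟶ redSub G E hE := inclusion hle
  have hιfac : ι ≫ redSubι G E hE = redSubι G Z hZ := inclusion_subschemeι hle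
  haveI : IsClosedImmersion ι :=
    @IsClosedImmersion.of_comp_isClosedImmersion _ _ _ ι (redSubι G E hE) inferInstance (by rw [hιfac]; infer_instance)
  haveI : IsLocallyNoetherian (redSub G E hE) := LocallyOfFiniteType.isLocallyNoetherian (redSubι G E hE)
  -- (P1) the model square of `W` with special fibre `Ẽ`
  let e' : redSub G E hE ⟶ (𝓔.comap j).subscheme := inclusion h𝓔E.le
  let e'' : (𝓔.comap j).subscheme ⟶ redSub G E hE := inclusion h𝓔E.ge
  have he₁ : e' ≫ e'' = 𝟙 _ := by
    simp only [e', e'', inclusion_comp]; exact inclusion_id _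
  have he₂ : e'' ≫ e' = 𝟙 _ := by
    simp only [e', e'', inclusion_comp]; exact inclusion_id _
  haveI : IsIso e' := ⟨e'', he₁, he₂⟩
  let jW : redSub G E hE ⟶ 𝓔.subscheme := e' ≫ subschemeComapHom j 𝓔
  let tW : redSub G E hE ⟶ Spec (.of k) := redSubι G E hE ≫ t
  have hjWι : jW ≫ 𝓔.subschemeι = redSubι G E hE ≫ j := by
    simp only [jW, Category.assoc, subschemeComapHom_ι]
    rw [← Category.assoc, inclusion_subschemeι]
  have hsqE : IsPullback (subschemeComapHom j 𝓔) ((𝓔.comap j).subschemeι ≫ t) w (Spec.map (CommRingCat.ofHom θ)) := by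
    rw [hw]; exact (isPullback_subschemeComapHom j 𝓔).paste_vert hsq
  have hsq₀ : IsPullback e' tW ((𝓔.comap j).subschemeι ≫ t) (𝟙 _) :=
    IsPullback.of_horiz_isIso ⟨by simp only [tW, Category.comp_id, e']; rw [← Category.assoc, inclusion_subschemeι]⟩
  have hsqW : IsPullback jW tW w (Spec.map (CommRingCat.ofHom θ)) := by
    simpa only [Category.id_comp] using hsq₀.paste_horiz hsqE
  -- the square `Ẽ → V(𝓔)` over `j : G → X`
  have hsqj₀ : IsPullback e' (redSubι G E hE) (𝓔.comap j).subschemeι (𝟙 G) :=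
    IsPullback.of_horiz_isIso ⟨by simp only [Category.comp_id, e']; exact inclusion_subschemeι _⟩
  have hsqj : IsPullback jW (redSubι G E hE) 𝓔.subschemeι j := by
    simpa only [Category.id_comp] using hsqj₀.paste_horiz (isPullback_subschemeComapHom j 𝓔)
  -- (P2) local complete intersection, and the Čech datum from `DirStepUnobs`
  have hlci := hP2 ι hZreg (hEreg ι hιfac)
  have hH1 := hunobs ι hιfac
  -- apply (F)
  obtain ⟨C₀, hC₀flat, hC₀comap⟩ :=
    hF O k θ hθ 𝓔.subscheme w (redSub G E hE) jW tW hsqW inferInstance inferInstance (redSub G Z hZ) ι inferInstance hlci hH1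
  -- (P3) transport to the stage
  let f : C₀.subscheme ⟶ X := C₀.subschemeι ≫ 𝓔.subschemeι
  let C : X.IdealSheafData := C₀.map 𝓔.subschemeι
  have hCf : C = f.ker := rfl
  -- the lift `Z̃ → V(C₀)` and its cartesian squares
  have hker : C₀.subschemeι.ker ≤ (ι ≫ jW).ker := by
    rw [ker_subschemeι, ← map_ker, ← hC₀comap]; exact le_map_comap _ _
  let l : redSub G Z hZ ⟶ C₀.subscheme := IsClosedImmersion.lift C₀.subschemeι (ι ≫ jW) hker
  have hlfac : l ≫ C₀.subschemeι = ι ≫ jW := IsClosedImmersion.lift_fac _ _ _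
  have hsql : IsPullback ι l jW C₀.subschemeι :=
    isPullback_of_isClosedImmersion ι C₀.subschemeι l jW hlfac.symm (by rw [ker_subschemeι, hC₀comap])
  -- special fibre of `V(C₀) → Spec O` is `Z̃`
  have hsqY : IsPullback l (ι ≫ tW) (C₀.subschemeι ≫ w) (Spec.map (CommRingCat.ofHom θ)) := hsql.flip.paste_vert hsqW
  -- `Z̃ = V(C₀) ×_X G`
  have hsqG : IsPullback l (ι ≫ redSubι G E hE) f j := hsql.flip.paste_vert hsqj
  haveI : IsProper (C₀.subschemeι ≫ w) := inferInstance
  haveI : Flat (C₀.subschemeι ≫ w) := hC₀flat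
  have hC₀reg : Scheme.IsRegular C₀.subscheme :=
    isRegular_of_flat_proper_of_isRegular_specialFibre θ hθ (C₀.subschemeι ≫ w) l (ι ≫ tW) hsqY hZreg
  haveI hfci : IsClosedImmersion f := IsClosedImmersion.comp C₀.subschemeι 𝓔.subschemeι
  haveI : IsIso f.toImage := by infer_instance
  have hCreg : Scheme.IsRegular f.image := Scheme.IsRegular.of_isOpenImmersion (inv f.toImage) hC₀reg
  refine ⟨C, ?_, ?_, ?_, ?_, ?_⟩
  · -- `𝓔 ≤ C`
    calc 𝓔 = (⊥ : 𝓔.subscheme.IdealSheafData).map 𝓔.subschemeι := by rw [Scheme.IdealSheafData.map_bot, ker_subschemeι]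
      _ ≤ C := map_mono _ bot_le
  · -- `V(C)` regular: `V(C) ≅ V(C₀)` by `f.toImage`
    exact hCreg
  · -- flat over `Spec O`: `V(C) ≅ V(C₀)` over `X`
    have h1 : f.toImage ≫ C.subschemeι ≫ σ ≫ q = C₀.subschemeι ≫ w := by
      change f.toImage ≫ f.imageι ≫ σ ≫ q = _
      rw [f.toImage_imageι_assoc, hw]; simp only [f, Category.assoc]
    have h2 : Flat (f.toImage ≫ C.subschemeι ≫ σ ≫ q) := by rw [h1]; exact hC₀flat
    exact (MorphismProperty.cancel_left_of_respectsIso @Flat f.toImage _).mp h2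
  · -- `C·𝒪_G = 𝓘⟨Z⟩`: `Z̃ = V(C₀) ×_X G`
    rw [hCf, ← ker_fst_of_isClosedImmersion f j, ← hsqG.flip.isoPullback_inv_fst, Scheme.Hom.ker_comp_of_isIso, hιfac,
      ker_subschemeι]
  · -- frames under the codimension-2 clause
    intro x hx hcodim
    have hx' : x ∈ Set.range C.subschemeι := by rw [range_subschemeι]; exact hx
    obtain ⟨s, rfl⟩ := hx'
    haveI := hXreg (C.subschemeι s)
    exact exists_twoFrame_of_codim_two C hCreg s hcodim

end Summit.ResolutionOfSingularities.ResolutionOfSingularities.Cruxes.EquisingularLiftNat.Sections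

end
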